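import Literature.Topology.FourManifolds.ClosedBallSmoothEmbeddings
import Literature.Topology.FourManifolds.IsotopyExtensionCorners
import Mathlib.Analysis.SpecialFunctions.SmoothTransition
import HarnessLib

/-!
# Shrinking an embedded disc inside a closed manifold by an ambient isotopy

Let `X` be a closed smooth manifold (compact, Hausdorff, modelled on `ℝᵐ` without boundary) and
`f : ℝⁿ⁺¹ → X` a `C^∞` map which is injective and immersive on the closed unit ball `𝔻ⁿ⁺¹`
(the presentation of embedded discs used throughout the topic, e.g. `Knot.IsSliceDiscIn`). The
radial contraction `F_t (x) = f (ρ(t) • x)`, `ρ` decreasing smoothly from `ρ(0) = 1` to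
`ρ(1) = r ∈ (0, 1]`, is a smooth isotopy of embeddings of the manifold with boundary `𝔻ⁿ⁺¹`
(`isSmoothEmbedding_comp_smul_coe_closedBall`, via `ClosedBallSmoothEmbeddings.lean`), so by the
**isotopy extension theorem** (Hirsch 1976, Ch. 8 §1, Thm. 1.3; the tree's
`SmoothIsotopy.exists_ambientIsotopy_comp_eq_holds`, any model with corners on the source) it is
covered by an ambient isotopy of `X`. Consequences proved here:

* `exists_ambientIsotopy_apply_disc_eq_smul` — an ambient isotopy `Ψ` of `X` with
  `Ψ₁ (f x) = f (r • x)` for all `x ∈ 𝔻ⁿ⁺¹`;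
* `exists_homeomorph_image_disc_eq` / `exists_homeomorph_image_disc_subset` — **a self-homeomorphism
  (indeed diffeomorphism) of `X` carrying the disc `f(𝔻ⁿ⁺¹)` onto the small disc `f(r • 𝔻ⁿ⁺¹)`,
  in particular into any prescribed neighbourhood `W` of `f 0`** (e.g. a chart domain). This is
  the geometric input making a smoothly embedded closed disc *cellular-like* for local homology
  (`H_q(X, X ∖ f(𝔻)) ≅ H_q(X, X ∖ f(r𝔻))`, the latter computable inside a chart), used for the slice
  discs of `Literature/Topology/FourManifolds/ZeroSurgeryHomotopyBallSliceProofs.lean`.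

Everything is proved; no named facts, no definitions (the radius profile
`ρ_r(t) = 1 - (1 - r) • smoothTransition t` is kept as an explicit expression and the isotopy is
built inside the proof of `exists_ambientIsotopy_apply_disc_eq_smul`).

## References

* M. W. Hirsch, *Differential Topology*, GTM 33 (1976), Ch. 8 §1, Thm. 1.3 (isotopy extension)
  and §8.3 (discs) [HirschDT1976].
* R. S. Palais, *Extending diffeomorphisms*, Proc. AMS 11 (1960) 274–277 [Palais1960].
-/

open scoped Manifold ContDiff Topology
open Set Function Metric

noncomputable section

namespace Literature.Topology.FourManifolds

/-! ### The radius profile `ρ_r(t) = 1 - (1 - r) • smoothTransition t` -/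

/-- `r ≤ ρ_r(t)` for `r ≤ 1`. [folklore] -/
theorem le_shrinkRadius {r : ℝ} (hr : r ≤ 1) (t : ℝ) :
    r ≤ 1 - (1 - r) * Real.smoothTransition t := by
  have h1 := Real.smoothTransition.le_one t
  have h0 := Real.smoothTransition.nonneg t
  nlinarith

/-- `ρ_r(t) ≤ 1` for `r ≤ 1`. [folklore] -/
theorem shrinkRadius_le_one {r : ℝ} (hr : r ≤ 1) (t : ℝ) :
    1 - (1 - r) * Real.smoothTransition t ≤ 1 := by
  have h0 := Real.smoothTransition.nonneg t
  nlinarith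

/-- `0 < ρ_r(t)` for `0 < r ≤ 1`. [folklore] -/
theorem shrinkRadius_pos {r : ℝ} (hr0 : 0 < r) (hr : r ≤ 1) (t : ℝ) :
    0 < 1 - (1 - r) * Real.smoothTransition t :=
  hr0.trans_le (le_shrinkRadius hr t)

/-- The radius profile is smooth. [folklore] -/
theorem contDiff_shrinkRadius (r : ℝ) :
    ContDiff ℝ ∞ (fun t : ℝ => 1 - (1 - r) * Real.smoothTransition t) :=
  contDiff_const.sub (contDiff_const.mul Real.smoothTransition.contDiff)

/-! ### The shrinking isotopy of an embedded disc -/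

section Shrinking

variable {n m : ℕ} {X : Type*} [TopologicalSpace X] [ChartedSpace (EuclideanSpace ℝ (Fin m)) X]
  [IsManifold (𝓡 m) ∞ X]

/-- Scaling the closed unit ball by `c` with `|c| ≤ 1` keeps it inside itself. [folklore] -/
theorem smul_mem_closedBall_of_abs_le_one {c : ℝ} (hc : |c| ≤ 1)
    {x : EuclideanSpace ℝ (Fin (n + 1))} (hx : x ∈ Metric.closedBall (0 : EuclideanSpace ℝ (Fin (n + 1))) 1) :
    c • x ∈ Metric.closedBall (0 : EuclideanSpace ℝ (Fin (n + 1))) 1 := by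
  rw [mem_closedBall_zero_iff] at hx ⊢
  rw [norm_smul, Real.norm_eq_abs]
  nlinarith [abs_nonneg c, norm_nonneg x]

/-- **Rescaled discs are embedded discs**: if `f : ℝⁿ⁺¹ → X` is `C^∞`, injective on `𝔻ⁿ⁺¹` and
immersive on `𝔻ⁿ⁺¹`, then for `0 < c ≤ 1` so is `x ↦ f (c • x)`, hence (by
`isSmoothEmbedding_comp_coe_closedBall_of_injective_mfderiv`) its restriction to `𝔻ⁿ⁺¹` is a
smooth embedding of the manifold with boundary `𝔻ⁿ⁺¹`. [cite: HirschDT1976, Ch. 1 §3 Thm. 3.1] -/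
theorem isSmoothEmbedding_comp_smul_coe_closedBall [T2Space X]
    {f : EuclideanSpace ℝ (Fin (n + 1)) → X} (hf : ContMDiff (𝓡 (n + 1)) (𝓡 m) ∞ f)
    (hinj : InjOn f (Metric.closedBall (0 : EuclideanSpace ℝ (Fin (n + 1))) 1))
    (hd : ∀ y ∈ Metric.closedBall (0 : EuclideanSpace ℝ (Fin (n + 1))) 1,
      Injective (mfderiv (𝓡 (n + 1)) (𝓡 m) f y))
    {c : ℝ} (hc0 : 0 < c) (hc1 : c ≤ 1) :
    Manifold.IsSmoothEmbedding (𝓡∂ (n + 1)) (𝓡 m) ∞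
      (fun x : Metric.closedBall (0 : EuclideanSpace ℝ (Fin (n + 1))) 1 =>
        f (c • (x : EuclideanSpace ℝ (Fin (n + 1))))) := by
  have habs : |c| ≤ 1 := by rwa [abs_of_pos hc0]
  have hsmul : ContMDiff (𝓡 (n + 1)) (𝓡 (n + 1)) ∞
      (fun x : EuclideanSpace ℝ (Fin (n + 1)) => c • x) :=
    (contDiff_const_smul c).contMDiff
  have hF : ContMDiff (𝓡 (n + 1)) (𝓡 m) ∞ (fun x : EuclideanSpace ℝ (Fin (n + 1)) => f (c • x)) :=
    hf.comp hsmul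
  have hinj' : InjOn (fun x : EuclideanSpace ℝ (Fin (n + 1)) => f (c • x))
      (Metric.closedBall (0 : EuclideanSpace ℝ (Fin (n + 1))) 1) := by
    intro x hx y hy hxy
    have h := hinj (smul_mem_closedBall_of_abs_le_one habs hx)
      (smul_mem_closedBall_of_abs_le_one habs hy) hxy
    exact smul_right_injective _ hc0.ne' h
  have hd' : ∀ y ∈ Metric.closedBall (0 : EuclideanSpace ℝ (Fin (n + 1))) 1,
      Injective (mfderiv (𝓡 (n + 1)) (𝓡 m) (fun x : EuclideanSpace ℝ (Fin (n + 1)) => f (c • x)) y) := by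
    intro y hy
    have h1 : MDifferentiableAt (𝓡 (n + 1)) (𝓡 m) f (c • y) :=
      hf.mdifferentiableAt (by simp)
    have h2 : MDifferentiableAt (𝓡 (n + 1)) (𝓡 (n + 1))
        (fun x : EuclideanSpace ℝ (Fin (n + 1)) => c • x) y :=
      hsmul.mdifferentiableAt (by simp)
    have hcomp := mfderiv_comp y h1 h2
    have hfun : (fun x : EuclideanSpace ℝ (Fin (n + 1)) => c • x) =
        ⇑(c • ContinuousLinearMap.id ℝ (EuclideanSpace ℝ (Fin (n + 1)))) := by
      ext x
      simp
    have hsm : mfderiv (𝓡 (n + 1)) (𝓡 (n + 1)) (fun x : EuclideanSpace ℝ (Fin (n + 1)) => c • x) y =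
        c • ContinuousLinearMap.id ℝ (EuclideanSpace ℝ (Fin (n + 1))) := by
      rw [mfderiv_eq_fderiv, hfun, ContinuousLinearMap.fderiv]
    change Injective
      (mfderiv (𝓡 (n + 1)) (𝓡 m) (f ∘ fun x : EuclideanSpace ℝ (Fin (n + 1)) => c • x) y)
    rw [hcomp, hsm]
    intro v w hvw
    have h : (c • ContinuousLinearMap.id ℝ (EuclideanSpace ℝ (Fin (n + 1)))) v =
        (c • ContinuousLinearMap.id ℝ (EuclideanSpace ℝ (Fin (n + 1)))) w :=
      hd (c • y) (smul_mem_closedBall_of_abs_le_one habs hy) hvw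
    exact smul_right_injective (EuclideanSpace ℝ (Fin (n + 1))) hc0.ne' h
  exact isSmoothEmbedding_comp_coe_closedBall_of_injective_mfderiv hF hinj' hd'

/-- **Ambient isotopy shrinking an embedded disc** (isotopy extension, Hirsch 1976, Ch. 8 §1,
Thm. 1.3, in the tree `SmoothIsotopy.exists_ambientIsotopy_comp_eq_holds`): for a closed manifold
`X` and `f : ℝⁿ⁺¹ → X` smooth, injective and immersive on `𝔻ⁿ⁺¹`, and `0 < r ≤ 1`, there is an
ambient isotopy `Ψ` of `X` with `Ψ_t (f x) = f (ρ_r(t) • x)` for `x ∈ 𝔻ⁿ⁺¹`, `t ∈ (-1/2, 3/2)`; in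
particular `Ψ₁ (f x) = f (r • x)`. [cite: HirschDT1976, Ch. 8 §1, Thm. 1.3] -/
theorem exists_ambientIsotopy_apply_disc_eq_smul [T2Space X] [CompactSpace X]
    {f : EuclideanSpace ℝ (Fin (n + 1)) → X} (hf : ContMDiff (𝓡 (n + 1)) (𝓡 m) ∞ f)
    (hinj : InjOn f (Metric.closedBall (0 : EuclideanSpace ℝ (Fin (n + 1))) 1))
    (hd : ∀ y ∈ Metric.closedBall (0 : EuclideanSpace ℝ (Fin (n + 1))) 1,
      Injective (mfderiv (𝓡 (n + 1)) (𝓡 m) f y))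
    {r : ℝ} (hr0 : 0 < r) (hr1 : r ≤ 1) :
    ∃ Ψ : AmbientIsotopy (𝓡 m) X,
      (∀ t ∈ Ioo (-1 / 2 : ℝ) (3 / 2), ∀ x ∈ Metric.closedBall (0 : EuclideanSpace ℝ (Fin (n + 1))) 1,
        Ψ.toFun t (f x) = f ((1 - (1 - r) * Real.smoothTransition t) • x)) ∧
      ∀ x ∈ Metric.closedBall (0 : EuclideanSpace ℝ (Fin (n + 1))) 1, Ψ.toFun 1 (f x) = f (r • x) := by
  -- the shrinking isotopy `F_t(x) = f (ρ_r(t) • x)` of embeddings of `𝔻ⁿ⁺¹` (Hirsch 1976, §8.1)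
  let F : SmoothIsotopy (𝓡∂ (n + 1)) (𝓡 m)
      (fun x : Metric.closedBall (0 : EuclideanSpace ℝ (Fin (n + 1))) 1 =>
        f ((1 - (1 - r) * Real.smoothTransition 0) • (x : EuclideanSpace ℝ (Fin (n + 1)))))
      (fun x : Metric.closedBall (0 : EuclideanSpace ℝ (Fin (n + 1))) 1 =>
        f ((1 - (1 - r) * Real.smoothTransition 1) • (x : EuclideanSpace ℝ (Fin (n + 1))))) :=
    { toFun := fun t x =>
        f ((1 - (1 - r) * Real.smoothTransition t) • (x : EuclideanSpace ℝ (Fin (n + 1))))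
      contMDiff := by
        have h1 : ContMDiff (𝓘(ℝ, ℝ).prod (𝓡∂ (n + 1))) 𝓘(ℝ, ℝ) ∞
            (fun p : ℝ × Metric.closedBall (0 : EuclideanSpace ℝ (Fin (n + 1))) 1 =>
              1 - (1 - r) * Real.smoothTransition p.1) :=
          (contDiff_shrinkRadius r).contMDiff.comp contMDiff_fst
        have h2 : ContMDiff (𝓘(ℝ, ℝ).prod (𝓡∂ (n + 1))) (𝓡 (n + 1)) ∞
            (fun p : ℝ × Metric.closedBall (0 : EuclideanSpace ℝ (Fin (n + 1))) 1 =>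
              (p.2 : EuclideanSpace ℝ (Fin (n + 1)))) :=
          contMDiff_coe_closedBall.comp contMDiff_snd
        exact hf.comp (h1.smul h2)
      isSmoothEmbedding := fun t =>
        isSmoothEmbedding_comp_smul_coe_closedBall hf hinj hd (shrinkRadius_pos hr0 hr1 t)
          (shrinkRadius_le_one hr1 t)
      map_zero := rfl
      map_one := rfl }
  obtain ⟨Ψ, hΨ⟩ := F.exists_ambientIsotopy_comp_eq_holds
  have key : ∀ t ∈ Ioo (-1 / 2 : ℝ) (3 / 2),
      ∀ x ∈ Metric.closedBall (0 : EuclideanSpace ℝ (Fin (n + 1))) 1,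
        Ψ.toFun t (f x) = f ((1 - (1 - r) * Real.smoothTransition t) • x) := by
    intro t ht x hx
    have h := hΨ t ht ⟨x, hx⟩
    simpa [F, Real.smoothTransition.zero] using h
  refine ⟨Ψ, key, fun x hx => ?_⟩
  have h := key 1 ⟨by norm_num, by norm_num⟩ x hx
  simpa [Real.smoothTransition.one] using h

/-- **A self-homeomorphism of a closed manifold shrinking an embedded disc**: under the hypotheses
of `exists_ambientIsotopy_apply_disc_eq_smul` there is `Ψ : X ≃ₜ X` (the time-`1` diffeomorphism
of the ambient isotopy) with `Ψ (f x) = f (r • x)` on `𝔻ⁿ⁺¹`, so `Ψ '' f(𝔻ⁿ⁺¹) = f(r • 𝔻ⁿ⁺¹)`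
and `Ψ '' f(c𝔻ⁿ⁺¹) = f (rc𝔻ⁿ⁺¹)` for every `0 ≤ c ≤ 1`. [cite: HirschDT1976, Ch. 8 §1, Thm. 1.3] -/
theorem exists_homeomorph_apply_disc_eq_smul [T2Space X] [CompactSpace X]
    {f : EuclideanSpace ℝ (Fin (n + 1)) → X} (hf : ContMDiff (𝓡 (n + 1)) (𝓡 m) ∞ f)
    (hinj : InjOn f (Metric.closedBall (0 : EuclideanSpace ℝ (Fin (n + 1))) 1))
    (hd : ∀ y ∈ Metric.closedBall (0 : EuclideanSpace ℝ (Fin (n + 1))) 1,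
      Injective (mfderiv (𝓡 (n + 1)) (𝓡 m) f y))
    {r : ℝ} (hr0 : 0 < r) (hr1 : r ≤ 1) :
    ∃ Ψ : X ≃ₜ X, ∀ x ∈ Metric.closedBall (0 : EuclideanSpace ℝ (Fin (n + 1))) 1,
      Ψ (f x) = f (r • x) := by
  obtain ⟨Ψ, -, h1⟩ := exists_ambientIsotopy_apply_disc_eq_smul hf hinj hd hr0 hr1
  exact ⟨(Ψ.toDiffeomorph 1).toHomeomorph, fun x hx => h1 x hx⟩

/-- The image of a scaled closed ball: `f '' (c • 𝔻) = {f (c • x) | x ∈ 𝔻}`. [folklore] -/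
theorem image_smul_closedBall_eq {Y : Type*} (f : EuclideanSpace ℝ (Fin (n + 1)) → Y) {c : ℝ}
    (hc : 0 < c) :
    f '' Metric.closedBall (0 : EuclideanSpace ℝ (Fin (n + 1))) c =
      (fun x => f (c • x)) '' Metric.closedBall (0 : EuclideanSpace ℝ (Fin (n + 1))) 1 := by
  ext y
  simp only [mem_image, mem_closedBall_zero_iff]
  constructor
  · rintro ⟨x, hx, rfl⟩
    refine ⟨c⁻¹ • x, ?_, by rw [smul_smul, mul_inv_cancel₀ hc.ne', one_smul]⟩
    rw [norm_smul, norm_inv, Real.norm_eq_abs, abs_of_pos hc]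
    exact (inv_mul_le_iff₀ hc).2 (by simpa using hx)
  · rintro ⟨x, hx, rfl⟩
    refine ⟨c • x, ?_, rfl⟩
    rw [norm_smul, Real.norm_eq_abs, abs_of_pos hc]
    nlinarith [norm_nonneg x]

/-- **Shrinking an embedded disc into a prescribed neighbourhood of its centre**: for a closed
manifold `X`, `f : ℝⁿ⁺¹ → X` smooth, injective and immersive on `𝔻ⁿ⁺¹`, and any open `W ∋ f 0`,
there are a radius `r ∈ (0, 1]` with `f(r𝔻ⁿ⁺¹) ⊆ W` and a homeomorphism `Ψ` of `X` with
`Ψ '' f(𝔻ⁿ⁺¹) = f(r𝔻ⁿ⁺¹)` (`⊆ W`). With `W` a chart domain this makes the local homology of `X`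
along the disc `f(𝔻ⁿ⁺¹)` computable inside `ℝᵐ`. [cite: HirschDT1976, Ch. 8 §1, Thm. 1.3] -/
theorem exists_homeomorph_image_disc_eq [T2Space X] [CompactSpace X]
    {f : EuclideanSpace ℝ (Fin (n + 1)) → X} (hf : ContMDiff (𝓡 (n + 1)) (𝓡 m) ∞ f)
    (hinj : InjOn f (Metric.closedBall (0 : EuclideanSpace ℝ (Fin (n + 1))) 1))
    (hd : ∀ y ∈ Metric.closedBall (0 : EuclideanSpace ℝ (Fin (n + 1))) 1,
      Injective (mfderiv (𝓡 (n + 1)) (𝓡 m) f y))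
    {W : Set X} (hW : IsOpen W) (h0 : f 0 ∈ W) :
    ∃ (r : ℝ) (_ : 0 < r) (_ : r ≤ 1) (Ψ : X ≃ₜ X),
      f '' Metric.closedBall (0 : EuclideanSpace ℝ (Fin (n + 1))) r ⊆ W ∧
      Ψ '' (f '' Metric.closedBall (0 : EuclideanSpace ℝ (Fin (n + 1))) 1) =
        f '' Metric.closedBall (0 : EuclideanSpace ℝ (Fin (n + 1))) r := by
  -- a small closed ball around `0` is mapped into `W`
  have hpre : f ⁻¹' W ∈ 𝓝 (0 : EuclideanSpace ℝ (Fin (n + 1))) :=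
    hf.continuous.continuousAt.preimage_mem_nhds (hW.mem_nhds h0)
  obtain ⟨ε, hε, hεW⟩ := Metric.nhds_basis_closedBall.mem_iff.1 hpre
  set r := min ε 1 with hr
  have hr0 : 0 < r := lt_min hε one_pos
  have hr1 : r ≤ 1 := min_le_right _ _
  have hrW : f '' Metric.closedBall (0 : EuclideanSpace ℝ (Fin (n + 1))) r ⊆ W := by
    rintro _ ⟨x, hx, rfl⟩
    exact hεW (closedBall_subset_closedBall (min_le_left _ _) hx)
  obtain ⟨Ψ, hΨ⟩ := exists_homeomorph_apply_disc_eq_smul hf hinj hd hr0 hr1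
  refine ⟨r, hr0, hr1, Ψ, hrW, ?_⟩
  rw [image_image, image_smul_closedBall_eq f hr0]
  exact image_congr fun x hx => hΨ x hx

/-- **Shrinking an embedded disc into a prescribed neighbourhood of its centre** (subset form of
`exists_homeomorph_image_disc_eq`). [cite: HirschDT1976, Ch. 8 §1, Thm. 1.3] -/
theorem exists_homeomorph_image_disc_subset [T2Space X] [CompactSpace X]
    {f : EuclideanSpace ℝ (Fin (n + 1)) → X} (hf : ContMDiff (𝓡 (n + 1)) (𝓡 m) ∞ f)
    (hinj : InjOn f (Metric.closedBall (0 : EuclideanSpace ℝ (Fin (n + 1))) 1))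
    (hd : ∀ y ∈ Metric.closedBall (0 : EuclideanSpace ℝ (Fin (n + 1))) 1,
      Injective (mfderiv (𝓡 (n + 1)) (𝓡 m) f y))
    {W : Set X} (hW : IsOpen W) (h0 : f 0 ∈ W) :
    ∃ Ψ : X ≃ₜ X, Ψ '' (f '' Metric.closedBall (0 : EuclideanSpace ℝ (Fin (n + 1))) 1) ⊆ W := by
  obtain ⟨r, -, -, Ψ, hrW, hΨ⟩ := exists_homeomorph_image_disc_eq hf hinj hd hW h0
  exact ⟨Ψ, hΨ ▸ hrW⟩

end Shrinking

end Literature.Topology.FourManifolds
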